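import Literature.NumberTheory.Transcendental.FormsAlgebraWedgeProofs
import HarnessLib

/-!
# The wedge of two `2`-forms evaluated on four vectors

A pointwise evaluation formula for the tree's shuffle wedge product
(`ContinuousAlternatingMap.wedge`, `Literature/NumberTheory/Transcendental/FormsAlgebra.lean`,
Warner's normalisation `(k! l!)⁻¹ ∑_σ sign σ …`), degree `(2, 2)`, real coefficients:

  `(β ∧ γ)(a, b, c, d) = β(a,b)γ(c,d) - β(a,c)γ(b,d) + β(a,d)γ(b,c)`
  `                     + β(c,d)γ(a,b) - β(b,d)γ(a,c) + β(b,c)γ(a,d)`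

(`wedge_apply_two_two`, the six `(2,2)`-shuffles; Warner (1983), 2.10(b)); in particular
`(ω ∧ ω)(a, b, c, d) = 2 (ω(a,b)ω(c,d) - ω(a,c)ω(b,d) + ω(a,d)ω(b,c))` (`wedge_self_apply_two`,
the Pfaffian).  Written for the fact seat of
`Literature.Geometry.Symplectic.mclean_divisorComplement_convex_four` (McLean 2012, Lemma 5.17:
the cut-off Stokes computation compares `dχ ∧ θ ∧ ω` with the symplectic volume `ω ∧ ω` on a
frame through the rotation vector).  Proof: two first-slot expansions of the alternating sum
(`sum_perm_sign_smul_comp_eq_sum_cons`).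

Everything is proved; no definitions, no named facts (D-0026).

## References

* F. W. Warner, *Foundations of Differentiable Manifolds and Lie Groups* (1983), 2.10(b).
  [Warner1983]
-/

noncomputable section

open Literature.NumberTheory.Transcendental

namespace ContinuousAlternatingMap

variable {V : Type*} [NormedAddCommGroup V] [NormedSpace ℝ V]

/-- The alternating sum over the two permutations of `Fin 2`. [folklore] -/
private theorem sum_perm_fin_two_sign_smul' {N : Type*} [AddCommGroup N]
    (f : Equiv.Perm (Fin 2) → N) :
    ∑ e : Equiv.Perm (Fin 2), (Equiv.Perm.sign e : ℤ) • f e = f 1 - f (Equiv.swap 0 1) := by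
  have huniv : (Finset.univ : Finset (Equiv.Perm (Fin 2))) = {1, Equiv.swap 0 1} := by decide
  rw [huniv, Finset.sum_pair (by decide), Equiv.Perm.sign_one, Equiv.Perm.sign_swap (by decide)]
  simp [sub_eq_add_neg]

omit [NormedAddCommGroup V] [NormedSpace ℝ V] in
/-- `Fin.removeNth` on short tuples. [folklore] -/
private theorem removeNth_zero_three'' (a b c : V) :
    (0 : Fin 3).removeNth (![a, b, c] : Fin 3 → V) = ![b, c] := by
  funext i; fin_cases i <;> rfl

omit [NormedAddCommGroup V] [NormedSpace ℝ V] in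
/-- `Fin.removeNth` on short tuples. [folklore] -/
private theorem removeNth_one_three'' (a b c : V) :
    (1 : Fin 3).removeNth (![a, b, c] : Fin 3 → V) = ![a, c] := by
  funext i; fin_cases i <;> rfl

omit [NormedAddCommGroup V] [NormedSpace ℝ V] in
/-- `Fin.removeNth` on short tuples. [folklore] -/
private theorem removeNth_two_three'' (a b c : V) :
    (2 : Fin 3).removeNth (![a, b, c] : Fin 3 → V) = ![a, b] := by
  funext i; fin_cases i <;> rfl

omit [NormedAddCommGroup V] [NormedSpace ℝ V] in
/-- `Fin.removeNth` on short tuples. [folklore] -/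
private theorem removeNth_zero_four (a b c d : V) :
    (0 : Fin 4).removeNth (![a, b, c, d] : Fin 4 → V) = ![b, c, d] := by
  funext i; fin_cases i <;> rfl

omit [NormedAddCommGroup V] [NormedSpace ℝ V] in
/-- `Fin.removeNth` on short tuples. [folklore] -/
private theorem removeNth_one_four (a b c d : V) :
    (1 : Fin 4).removeNth (![a, b, c, d] : Fin 4 → V) = ![a, c, d] := by
  funext i; fin_cases i <;> rfl

omit [NormedAddCommGroup V] [NormedSpace ℝ V] in
/-- `Fin.removeNth` on short tuples. [folklore] -/
private theorem removeNth_two_four (a b c d : V) :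
    (2 : Fin 4).removeNth (![a, b, c, d] : Fin 4 → V) = ![a, b, d] := by
  funext i; fin_cases i <;> rfl

omit [NormedAddCommGroup V] [NormedSpace ℝ V] in
/-- `Fin.removeNth` on short tuples. [folklore] -/
private theorem removeNth_three_four (a b c d : V) :
    (3 : Fin 4).removeNth (![a, b, c, d] : Fin 4 → V) = ![a, b, c] := by
  funext i; fin_cases i <;> rfl

/-- The inner alternating sum of the `(2,2)` shuffle formula (one vector of `β` frozen):
`∑_{e ∈ 𝔖₃} sign e · β(x, w_{e0}) γ(w_{e1}, w_{e2})`
`= 2 (β(x,w₀)γ(w₁,w₂) - β(x,w₁)γ(w₀,w₂) + β(x,w₂)γ(w₀,w₁))`.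
[folklore] -/
theorem sum_perm_three_sign_smul_apply (β γ : V [⋀^Fin 2]→L[ℝ] ℝ) (x : V) (p q r : V) :
    ∑ e : Equiv.Perm (Fin (2 + 1)), (Equiv.Perm.sign e : ℤ) •
        (β ![x, ((![p, q, r] : Fin (2 + 1) → V) ∘ e) 0] *
          γ ![((![p, q, r] : Fin (2 + 1) → V) ∘ e) 1, ((![p, q, r] : Fin (2 + 1) → V) ∘ e) 2]) =
      2 * (β ![x, p] * γ ![q, r] - β ![x, q] * γ ![p, r] + β ![x, r] * γ ![p, q]) := by
  set g : (Fin (2 + 1) → V) → ℝ := fun z ↦ β ![x, z 0] * γ ![z 1, z 2] with hg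
  have h1 : ∑ e : Equiv.Perm (Fin (2 + 1)), (Equiv.Perm.sign e : ℤ) •
      (β ![x, ((![p, q, r] : Fin (2 + 1) → V) ∘ e) 0] *
        γ ![((![p, q, r] : Fin (2 + 1) → V) ∘ e) 1, ((![p, q, r] : Fin (2 + 1) → V) ∘ e) 2]) =
      ∑ e : Equiv.Perm (Fin (2 + 1)), (Equiv.Perm.sign e : ℤ) • g (![p, q, r] ∘ e) := rfl
  rw [h1, sum_perm_sign_smul_comp_eq_sum_cons, Fin.sum_univ_three]
  simp only [sum_perm_fin_two_sign_smul', hg, Fin.cons_zero]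
  have hsw2 : ∀ p q : V, ((![p, q] : Fin 2 → V) ∘ (Equiv.swap (0 : Fin 2) 1)) = ![q, p] :=
    fun p q ↦ by funext i; fin_cases i <;> rfl
  have hid2 : ∀ p q : V, ((![p, q] : Fin 2 → V) ∘ (1 : Equiv.Perm (Fin 2))) = ![p, q] :=
    fun p q ↦ by funext i; rfl
  have hc1 : ∀ x p q : V, (Fin.cons x (![p, q] : Fin 2 → V) : Fin 3 → V) 1 = p := fun x p q ↦ rfl
  have hc2 : ∀ x p q : V, (Fin.cons x (![p, q] : Fin 2 → V) : Fin 3 → V) 2 = q := fun x p q ↦ rfl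
  have hv0 : (![p, q, r] : Fin 3 → V) 0 = p := rfl
  have hv1 : (![p, q, r] : Fin 3 → V) 1 = q := rfl
  have hv2 : (![p, q, r] : Fin 3 → V) 2 = r := rfl
  simp only [removeNth_zero_three'', removeNth_one_three'', removeNth_two_three'', hsw2, hid2, hc1,
    hc2, hv0, hv1, hv2]
  have hsw : ∀ p q : V, γ ![q, p] = -γ ![p, q] := fun p q ↦ by
    have h := γ.map_swap ![p, q] (i := 0) (j := 1) (by decide)
    rw [hsw2] at h
    exact h
  rw [hsw q r, hsw p r, hsw p q]
  simp only [Fin.val_zero, Fin.val_one, Fin.val_two, pow_zero, pow_one, one_smul, neg_smul,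
    even_two.neg_pow, one_pow]
  ring

/-- **The wedge of two `2`-forms on four vectors** (the six `(2,2)`-shuffles; Warner (1983),
2.10(b), `k = l = 2`, real coefficients). [cite: Warner1983] -/
theorem wedge_apply_two_two (β γ : V [⋀^Fin 2]→L[ℝ] ℝ) (a b c d : V) :
    β.wedge γ ![a, b, c, d] =
      β ![a, b] * γ ![c, d] - β ![a, c] * γ ![b, d] + β ![a, d] * γ ![b, c] +
        β ![c, d] * γ ![a, b] - β ![b, d] * γ ![a, c] + β ![b, c] * γ ![a, d] := by
  set f : (Fin (3 + 1) → V) → ℝ := fun z ↦ β ![z 0, z 1] * γ ![z 2, z 3] with hf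
  have h1 : β.wedge γ ![a, b, c, d] = ((Nat.factorial 2 * Nat.factorial 2 : ℕ) : ℝ)⁻¹ •
      ∑ σ : Equiv.Perm (Fin (3 + 1)), (Equiv.Perm.sign σ : ℤ) • f (![a, b, c, d] ∘ σ) := by
    rw [wedge_apply_zsmul]
    congr 1
    refine Fintype.sum_equiv (Equiv.refl _) _ _ fun σ ↦ ?_
    simp only [Equiv.refl_apply, hf, Function.comp_apply]
    congr 2
    · congr 1
      funext i; fin_cases i <;> rfl
    · congr 1
      funext j; fin_cases j <;> rfl
  rw [h1, sum_perm_sign_smul_comp_eq_sum_cons, Fin.sum_univ_four]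
  -- the inner sums, frozen first vector
  have hc1 : ∀ (x : V) (w : Fin 3 → V), (Fin.cons x w : Fin 4 → V) 1 = w 0 := fun x w ↦ rfl
  have hc2 : ∀ (x : V) (w : Fin 3 → V), (Fin.cons x w : Fin 4 → V) 2 = w 1 := fun x w ↦ rfl
  have hc3 : ∀ (x : V) (w : Fin 3 → V), (Fin.cons x w : Fin 4 → V) 3 = w 2 := fun x w ↦ rfl
  have hv0 : (![a, b, c, d] : Fin 4 → V) 0 = a := rfl
  have hv1 : (![a, b, c, d] : Fin 4 → V) 1 = b := rfl
  have hv2 : (![a, b, c, d] : Fin 4 → V) 2 = c := rfl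
  have hv3 : (![a, b, c, d] : Fin 4 → V) 3 = d := rfl
  simp only [hf, Fin.cons_zero, hc1, hc2, hc3, hv0, hv1, hv2, hv3, removeNth_zero_four,
    removeNth_one_four, removeNth_two_four, removeNth_three_four,
    sum_perm_three_sign_smul_apply]
  -- antisymmetry of `β` on the swapped pairs
  have hsw2 : ∀ p q : V, ((![p, q] : Fin 2 → V) ∘ (Equiv.swap (0 : Fin 2) 1)) = ![q, p] :=
    fun p q ↦ by funext i; fin_cases i <;> rfl
  have hswβ : ∀ p q : V, β ![q, p] = -β ![p, q] := fun p q ↦ by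
    have h := β.map_swap ![p, q] (i := 0) (j := 1) (by decide)
    rw [hsw2] at h
    exact h
  rw [hswβ a b, hswβ a c, hswβ b c, hswβ a d, hswβ b d, hswβ c d]
  have h3 : ((3 : Fin (3 + 1)) : ℕ) = 3 := rfl
  simp only [Fin.val_zero, Fin.val_one, Fin.val_two, h3, pow_zero, one_smul,
    even_two.neg_pow, one_pow, Nat.factorial_two, smul_eq_mul, zsmul_eq_mul, Int.cast_pow,
    Int.cast_neg, Int.cast_one]
  ring

/-- **The square of a `2`-form on four vectors (the Pfaffian)**:
`(ω ∧ ω)(a, b, c, d) = 2 (ω(a,b)ω(c,d) - ω(a,c)ω(b,d) + ω(a,d)ω(b,c))`. [cite: Warner1983] -/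
theorem wedge_self_apply_two (ω2 : V [⋀^Fin 2]→L[ℝ] ℝ) (a b c d : V) :
    ω2.wedge ω2 ![a, b, c, d] =
      2 * (ω2 ![a, b] * ω2 ![c, d] - ω2 ![a, c] * ω2 ![b, d] + ω2 ![a, d] * ω2 ![b, c]) := by
  rw [wedge_apply_two_two]
  ring

end ContinuousAlternatingMap
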